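import Literature.MathematicalPhysics.QuantumFieldTheory.Balaban1983to89.B8Prop5Reality

/-!
# `Balaban1983to89.B8Prop5ContractionKLevelSrc` — [Balaban1985RegularSpaces] Proposition 5's contraction (Sect. D pp. 92–94) WITH A SOURCE:
# the engine `B8Prop5ContractionKLevel.propFive_fixedPoint_kLevel` re-run for the fixed-point equation of THEOREM 8's gauge condition (1.146)
# «R(U₀)D*_{U₀}A₁ = f» — the source `f` enters the machine UN-CONJUGATED, as `W_λ ↦ W_λ − f`

statement-level skeleton of published theorems with citation tags; proofs where landed; nothing here is a claim about the Yang–Mills mass gap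

T. Bałaban, *Spaces of regular gauge field configurations on a lattice and gauge fixing conditions*, Commun. Math. Phys. **99** (1985) 75–102
`[Balaban1985RegularSpaces]` ("B8"; journal page = PDF page + 74): Prop. 5 p. 94, (1.95)–(1.106) pp. 92–94, Thm 8 (1.146) p. 101 («Let us formulate the
following generalization of Theorem 2. … there exists exactly one gauge transformation u satisfying (1.29) and such, that the conditions (1.36), (1.37),
(1.39), and (1.146) hold … Inspecting the proofs of the theorems and propositions of this section we see that only some constants change»).

## WHY THIS FILE (cell `pub-ymgap`, HUMAN RULING D-0062; R134 seat `pub-ymgap-dag-n05-d` g5, DAG node N05 = [B8]; count-neutral)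

After `BalabanUVNodesN05SubBKnitZdLanT8B9` (p496434) the N05 knit displays Theorem 8 through five SOURCED sockets at the law members; three of them —
`SP5base`, `SP5`, `SP5u` — are PROPOSITION 5 (existence ∕ uniqueness) AT THE SOURCED GAUGE CONDITION (1.146), i.e. [Balaban1985RegularSpaces]-own
content whose providers are «the JOIN twins with the particular solution» (seat n05-c g4, located, not started).  The un-sourced providers
(`B8SockHFPRD.sockHFP(₀)_body_of_join_RD`, `B8SockP5uEAssemblyB`) bottom out in the CONTRACTION ENGINE `B8Prop5ContractionKLevel.propFive_fixedPoint_kLevel`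
(∃! fixed point of `λ = G′(Ψλ)`, `Ψλ = R(−Z_λ)`, `Z_λ = (I + V_{λ′}R)⁻¹ W_λ`).  That engine keeps the divergence datum `DA` FREE — but the source of (1.146)
is NOT a datum of that slot: in `W_λ = Wsrc η U₀ A DA λ′ E = conjR(e^{−iλ′})(DA) + gAd(E)λ′ + Σ_μ 𝔉₃` every summand is CONJUGATED by the gauge
transformation (it is the divergence `D*_{U₀}A₁` of the gauge-fixed exponent, (1.86)–(1.88)), whereas (1.146) asks `R(D*A₁ − f) = 0` with `f` a FIXED
function of `R(U₀)`; `DA := D*A − f` would solve `R(D*A₁ − Ad(u⁻¹)f) = 0` instead.  THE HONEST SOURCED MACHINE is `W_λ ↦ W_λ − f`: at a fixed point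
`λ = G′R(−Z′)`, `Z′ + V(RZ′) = W − f` (the Neumann identity) gives `D*A₁ − f = Z′ − RZ′ = (1 − R)Z′`, hence `R(D*A₁ − f) = 0` by `R² = R` — exactly
as the un-sourced identity `Z + V(RZ) = W` gives `R(D*A₁) = 0` (`B8Prop5ContractionKLevel` module docstring).

THIS FILE is that engine, the landed proof RE-RUN with ONE extra additive term:
* §1 `psiP5src_bd2`, `psiP5src_sub_bd2` — the size and the Lipschitz modulus of `Ψ_f λ = R(−Zsol (W_λ − f) V_{λ′} R)` on the ¼α₄-ball, for any
  `f` with `|f|₍₋₂₎ ≤ m_f` on the `Ω_j` (`Bd2 … f m_f`): the constants are the engine's `Mc`, `Kc` READ AT `mE + m_f ∕ 2` — `mWc` is affine in `mE`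
  with slope 2, so `|W − f|₍₋₂₎ ≤ mWc(mE) + m_f = mWc(mE + m_f∕2)`, and `f` CANCELS in `W_s − W_t`, so the engine's modulus `KWc(mE) ≤ KWc(mE + m_f∕2)`
  serves (no new constant is introduced; the consumers' window lemmas apply with `mE ↦ mE + m_f∕2`).
* §2 ★ `propFive_fixedPoint_kLevel_src` — **there is exactly one `s` with `‖s‖ ≤ ¼α₄` and `λ_s = G′(Ψ_f λ_s)`**, under the engine's hypotheses with the
  windows (1.103)∕(1.106) read at `mE + m_f∕2`; `propFive_fixedPoint_kLevel_src_spec` — the Neumann identity `Z′ + V_{λ′}(RZ′) = W − f` on every `Ω_j`,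
  `|Z′|₍₋₂₎ ≤ 2·mWc(mE + m_f∕2)`, `‖s‖ ≤ B_G·M`, `λ_s = 0` off `Ω₀`.
* §3 `propFive_fixedPoint_kLevel_src_selfAdjoint` — the fixed point is HERMITIAN when, in addition to the engine's reality data, `f` is Hermitian on the
  `Ω_j` (`B8Prop5Reality` BY NAME: `isSelfAdjoint_Wsrc`, `isSelfAdjoint_zsol`, `fixedPoint_kLevel_selfAdjoint_of_ball`).
WHAT REMAINS for the sourced providers (NOT here; located for the n04-b ∕ n05-c ∕ n19-b lineages): the layers above the engine —
`B8Prop5GaugeParamKLevel.gaugeParam_kLevel` (JOIN-A), `B8Prop5JoinHFP.hFP_kLevel_of179` (multiplier form of (1.146) from the fixed point via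
`B8Eq195Linear.fixedPoint_iff_constraint_and_multiplier` with `N λ := N₀ λ − f`), `B8Prop5JoinSectELocalRD`, `B8SockHFPRD`, `B8Prop5ExistsZdLan` and the
uniqueness side `B8Prop5UniqKLevelB` → `B8Prop5UniqSectEW` → `B8Prop5UniqueZdLan`, each re-run on `Ψ_f`; and the reading of (1.146) at the
INTERMEDIATE levels of Theorem 4's induction (`InR138` is level-dependent; the knit's `LanF` is free below the top).

SOURCE TYPING (seat n05-c g5's kernel negative `B8LeafModelZd3SourceReality.not_b8LeafOfRecordSubB`, p501857, landed while this file was being typed): on the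
carrier `zdGF3` the source space `Src := Site d → 𝔸` with `InR := InR138` admits NON-Hermitian and unbounded sources, for which Theorem 8's typed sentence is
false — so the sourced sockets of the T8 knits are satisfiable only once the source is read as print's «f from the space R(U₀)» of 𝔤-VALUED functions of finite
norm (repair ρ1∕ρ2 there).  THIS ENGINE ALREADY TAKES THE SOURCE IN THAT CURRENCY: `f` is a fixed function with a `Bd2` bound (`hf`, finite `|f|₍₋₂₎`) and, for
the reality of the fixed point (§3), Hermitian on the `Ω_j` (`hfsa`) — nothing here depends on the carrier's `InR` field.

## HONEST SCOPE

A re-run of a landed engine with one extra additive term; the only analytic input added is `Bd2.sub`; nothing of [4] (the letters `G′`, `R` are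
hypotheses with the (1.101)∕(1.98) bounds), of Sect. E, or of Proposition 5's conclusion (1.107) is asserted.  Count-neutral; N05 NOT discharged;
one finite `T⁴` programme at fixed `ε`, Bałaban as printed — nothing continuum ∕ ℝ⁴ ∕ OS ∕ mass-gap ∕ Clay.  No `sorry`, no `axiom`, no `instance`;
ONE definition (`PsiP5src`, the sourced nonlinearity, = `PsiP5` at `f = 0`).  Unit `pub-ymgap-dag-n05-d` (g5), 2026-08-27.

[cite: Balaban1985RegularSpaces, Prop. 5 p.94, (1.95)–(1.96) p.92, (1.98)–(1.103) pp.92–93, (1.104)–(1.106) p.94, Thm 8 (1.146) p.101;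
Balaban1985BackgroundPropagators, (3.24)–(3.25) p.394 (the letters, hypotheses)]
-/

noncomputable section

open NormedSpace Metric Set Filter Topology
open Complex (I)

namespace Literature.MathematicalPhysics.QuantumFieldTheory.Balaban1983to89.B8Prop5ContractionKLevelSrc

open B7Prop1Explicit (e)
open B7Prop2Explicit (unitaryUnits)
open B7Eq78Linearization (conjR)
open B8Ineq132 (covDerivFwd covDeriv)
open B8Eq184Proof (gaugeExp)
open B8LambdaSpaceKLevel (wt wt_pos wt_nonneg lamSubK lamOf lamOf_sub norm_le_iff norm_sub_le_iff fixedPoint_kLevel)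
open B8Prop5ContractionKLevel (Bd2 Zsol Vop Wsrc PsiP5 Mc Kc mWc KWc mWc_nonneg KWc_nonneg zsol_eq bd2_zsol bd2_zsol_sub_zsol Vop_sub norm_Vop_le
  norm_Vop_sub_Vop_le wt_sq_norm_Wsrc_le wt_sq_norm_Wsrc_sub_le)
open B8Prop5Reality (isSelfAdjoint_Wsrc isSelfAdjoint_Vop isSelfAdjoint_zsol fixedPoint_kLevel_selfAdjoint_of_ball)

-- `Site` alone could resolve to the torus sites of `Setup.lean`; re-export the `ℤ^d` sites of `B7Prop1Explicit`.
export B7Prop1Explicit (Site)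

variable {d : ℕ}

/-! ## §0 The sourced nonlinearity `Ψ_f λ = R(−Z′_λ)`, `Z′_λ = (I + V_{λ′}R)⁻¹(W_λ − f)` -/

section Defs

variable {𝔸 : Type*} [NormedRing 𝔸] [NormOneClass 𝔸] [NormedAlgebra ℂ 𝔸] [CompleteSpace 𝔸]

/-- **THE NONLINEARITY OF (1.100) WITH A SOURCE `f`** (Theorem 8's (1.146) «R(U₀)D*_{U₀}A₁ = f»): `Ψ_f(λ) = R(−Z′_λ)` with
`Z′_λ = (I + V_{λ′}R)⁻¹(W_λ − f)` — `B8Prop5ContractionKLevel.PsiP5` with the source subtracted from `W_λ` BEFORE the Neumann inversion (the source is a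
fixed function, not conjugated by the gauge transformation).  `PsiP5src … 0 … = PsiP5 …` (`psiP5src_zero`). [cite: Balaban1985RegularSpaces, (1.95)–(1.96) p.92, (1.100) p.93, Thm 8 (1.146) p.101] -/
def PsiP5src (η : ℝ) (U₀ : Site d → Fin d → 𝔸ˣ) (A : Site d → Fin d → 𝔸) (DA f : Site d → 𝔸) (R gpar Eterm : (Site d → 𝔸) → (Site d → 𝔸))
    (lam : Site d → 𝔸) : Site d → 𝔸 :=
  R (fun x => -Zsol (Wsrc η U₀ A DA (gpar lam) (Eterm lam) - f) (Vop (gpar lam)) R x)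

omit [NormOneClass 𝔸] in
/-- At `f = 0` the sourced nonlinearity IS the engine's `PsiP5` (`sub_zero`). [cite: Balaban1985RegularSpaces, (1.100) p.93 (bookkeeping)] -/
theorem psiP5src_zero (η : ℝ) (U₀ : Site d → Fin d → 𝔸ˣ) (A : Site d → Fin d → 𝔸) (DA : Site d → 𝔸) (R gpar Eterm : (Site d → 𝔸) → (Site d → 𝔸))
    (lam : Site d → 𝔸) : PsiP5src η U₀ A DA 0 R gpar Eterm lam = PsiP5 η U₀ A DA R gpar Eterm lam := by
  simp only [PsiP5src, PsiP5, sub_zero]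

/-- The engine's size constant is affine in `mE` with slope 2: `mWc(mE) + m_f = mWc(mE + m_f∕2)` — how the source's size is booked without a new
constant. [cite: Balaban1985RegularSpaces, (1.99) p.93 (bookkeeping)] -/
theorem mWc_add_half (d : ℕ) (b₁ cA mE cDA mf : ℝ) : mWc d b₁ cA mE cDA + mf = mWc d b₁ cA (mE + mf / 2) cDA := by
  unfold mWc; ring

/-- The engine's Lipschitz constant is monotone in `mE`: `KWc(mE) ≤ KWc(mE + m_f∕2)` for `m_f, ℓ₀ ≥ 0` (the source cancels in `W_s − W_t`, so the
engine's modulus serves). [cite: Balaban1985RegularSpaces, (1.106) p.94 (bookkeeping)] -/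
theorem KWc_le_add_half (d : ℕ) {b₁ cA mE cDA KE ℓ₀ ℓ₁ mf : ℝ} (hmf : 0 ≤ mf) (hℓ₀ : 0 ≤ ℓ₀) :
    KWc d b₁ cA mE cDA KE ℓ₀ ℓ₁ ≤ KWc d b₁ cA (mE + mf / 2) cDA KE ℓ₀ ℓ₁ := by
  unfold KWc; nlinarith

end Defs

/-! ## §1 The size and the Lipschitz modulus of `Ψ_f` on the ball -/

section PsiBounds

variable {𝔸 : Type*} [NormedRing 𝔸] [NormOneClass 𝔸] [NormedAlgebra ℂ 𝔸] [CompleteSpace 𝔸]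
variable {L k : ℕ} {η : ℝ} {Ω : ℕ → Set (Site d)} {Eb : ℕ → Set (Site d × Fin d)} {U₀ : Site d → Fin d → 𝔸ˣ}
  {A : Site d → Fin d → 𝔸} {DA f : Site d → 𝔸}

/-- **(1.98)R + (1.99) for `Ψ_f = R(−Z′)` on the ball**: `|Ψ_f(λ_s)|₍₋₂₎ ≤ M` for `‖s‖ ≤ ¼α₄`, `M = Mc d B_R b₁ c_A (mE + m_f∕2) c_{DA}`
(`B8Prop5PsiBounds.psiP5_bd2` with `|W − f|₍₋₂₎ ≤ mWc + m_f`). [cite: Balaban1985RegularSpaces, (1.98)–(1.99) pp.92–93, Thm 8 p.101] -/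
theorem psiP5src_bd2 (hL : 1 ≤ L) (hη : 0 < η) (R gpar Eterm : (Site d → 𝔸) → (Site d → 𝔸))
    {α₄ BR a₁ b₁ cA cDA mE mf : ℝ}
    (hBR : 0 ≤ BR) (ha₁ : 0 ≤ a₁) (ha₁' : a₁ ≤ 1 / 24) (hb₁ : 0 < b₁) (hb₁' : b₁ ≤ 1 / 140)
    (hcA : 0 ≤ cA) (hcA' : cA ≤ 1 / 13) (hcDA : 0 ≤ cDA) (hmE : 0 ≤ mE) (hmf : 0 ≤ mf) (hθ : 10 * a₁ * BR ≤ 1 / 2)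
    (hRsub : ∀ f g : Site d → 𝔸, R (f - g) = R f - R g)
    (hRbd : ∀ (f : Site d → 𝔸) (m : ℝ), 0 ≤ m → Bd2 L η k Ω f m → Bd2 L η k Ω (R f) (BR * m))
    (hg0 : ∀ s : lamSubK η U₀ L k Eb, ‖s‖ ≤ α₄ / 4 → ∀ j, j ≤ k → ∀ x ∈ Ω j, ‖gpar (lamOf s) x‖ ≤ a₁)
    (hg1 : ∀ s : lamSubK η U₀ L k Eb, ‖s‖ ≤ α₄ / 4 → ∀ j, j ≤ k → ∀ x ∈ Ω j, ∀ μ : Fin d,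
      wt L η j * ‖covDerivFwd η U₀ μ (gpar (lamOf s)) x‖ ≤ b₁ ∧ wt L η j * ‖covDeriv η U₀ μ (gpar (lamOf s)) x‖ ≤ b₁)
    (hE0 : ∀ s : lamSubK η U₀ L k Eb, ‖s‖ ≤ α₄ / 4 → Bd2 L η k Ω (Eterm (lamOf s)) mE)
    (hDA : Bd2 L η k Ω DA cDA) (hf : Bd2 L η k Ω f mf)
    (hA : ∀ j, j ≤ k → ∀ x ∈ Ω j, ∀ μ : Fin d,
      wt L η j * ‖A x μ‖ ≤ cA ∧ wt L η j * ‖conjR (U₀ (x - e μ) μ)⁻¹ (A (x - e μ) μ)‖ ≤ cA)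
    (s : lamSubK η U₀ L k Eb) (hs : ‖s‖ ≤ α₄ / 4) :
    Bd2 L η k Ω (PsiP5src η U₀ A DA f R gpar Eterm (lamOf s)) (Mc d BR b₁ cA (mE + mf / 2) cDA) := by
  have hmW : 0 ≤ mWc d b₁ cA mE cDA := mWc_nonneg hb₁.le hcA hmE hcDA
  have hmW' : 0 ≤ mWc d b₁ cA (mE + mf / 2) cDA := mWc_nonneg hb₁.le hcA (by positivity) hcDA
  have hcV : 0 ≤ 10 * a₁ := by positivity
  have ha12 : a₁ ≤ 1 / 12 := by linarith
  have hb70 : b₁ ≤ 1 / 70 := by linarith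
  have hcA12 : cA ≤ 1 / 12 := by linarith
  have hVsub : ∀ f g : Site d → 𝔸, ∀ j, j ≤ k → ∀ x ∈ Ω j,
      Vop (gpar (lamOf s)) f x - Vop (gpar (lamOf s)) g x = Vop (gpar (lamOf s)) (f - g) x :=
    fun f g j hj x hx => Vop_sub f g ((hg0 s hs j hj x hx).trans ha12)
  have hVbd : ∀ f : Site d → 𝔸, ∀ j, j ≤ k → ∀ x ∈ Ω j, ‖Vop (gpar (lamOf s)) f x‖ ≤ 10 * a₁ * ‖f x‖ :=
    fun f j hj x hx => norm_Vop_le f (hg0 s hs j hj x hx) ha12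
  have hW : Bd2 L η k Ω (Wsrc η U₀ A DA (gpar (lamOf s)) (Eterm (lamOf s))) (mWc d b₁ cA mE cDA) :=
    fun j hj x hx => wt_sq_norm_Wsrc_le hL hη hb70 hcA hcA12 ((hg0 s hs j hj x hx).trans ha12) (hg1 s hs j hj x hx) (hA j hj x hx)
      (hE0 s hs j hj x hx) (hDA j hj x hx)
  have hW' : Bd2 L η k Ω (Wsrc η U₀ A DA (gpar (lamOf s)) (Eterm (lamOf s)) - f) (mWc d b₁ cA (mE + mf / 2) cDA) := by
    rw [← mWc_add_half]; exact hW.sub hf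
  have hZ := bd2_zsol hL hη hVsub hVbd hRsub hRbd hW' hcV hBR hmW' hθ
  exact hRbd _ _ (by positivity) hZ.neg

/-- **(1.106) for `Ψ_f = R(−Z′)` on the ball**: `|Ψ_f(λ_s) − Ψ_f(λ_t)|₍₋₂₎ ≤ K‖s − t‖` for `‖s‖, ‖t‖ ≤ ¼α₄`, `K = Kc d B_R b₁ c_A (mE + m_f∕2) c_{DA} K_E ℓ₀ ℓ₁`
(`B8Prop5PsiBounds.psiP5_sub_bd2`; the source cancels in `W_s − W_t`, `KWc(mE) ≤ KWc(mE + m_f∕2)`). [cite: Balaban1985RegularSpaces, (1.104)–(1.106) p.94, Thm 8 p.101] -/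
theorem psiP5src_sub_bd2 (hL : 1 ≤ L) (hη : 0 < η) (R gpar Eterm : (Site d → 𝔸) → (Site d → 𝔸))
    {α₄ BR a₁ b₁ cA cDA mE KE ℓ₀ ℓ₁ mf : ℝ}
    (hBR : 0 ≤ BR) (ha₁ : 0 ≤ a₁) (ha₁' : a₁ ≤ 1 / 24) (hb₁ : 0 < b₁) (hb₁' : b₁ ≤ 1 / 140)
    (hcA : 0 ≤ cA) (hcA' : cA ≤ 1 / 13) (hcDA : 0 ≤ cDA) (hmE : 0 ≤ mE) (hKE : 0 ≤ KE) (hℓ₀ : 0 ≤ ℓ₀) (hℓ₁ : 0 ≤ ℓ₁) (hmf : 0 ≤ mf)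
    (hθ : 10 * a₁ * BR ≤ 1 / 2)
    (hRsub : ∀ f g : Site d → 𝔸, R (f - g) = R f - R g)
    (hRbd : ∀ (f : Site d → 𝔸) (m : ℝ), 0 ≤ m → Bd2 L η k Ω f m → Bd2 L η k Ω (R f) (BR * m))
    (hg0 : ∀ s : lamSubK η U₀ L k Eb, ‖s‖ ≤ α₄ / 4 → ∀ j, j ≤ k → ∀ x ∈ Ω j, ‖gpar (lamOf s) x‖ ≤ a₁)
    (hg1 : ∀ s : lamSubK η U₀ L k Eb, ‖s‖ ≤ α₄ / 4 → ∀ j, j ≤ k → ∀ x ∈ Ω j, ∀ μ : Fin d,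
      wt L η j * ‖covDerivFwd η U₀ μ (gpar (lamOf s)) x‖ ≤ b₁ ∧ wt L η j * ‖covDeriv η U₀ μ (gpar (lamOf s)) x‖ ≤ b₁)
    (hgL : ∀ s t : lamSubK η U₀ L k Eb, ‖s‖ ≤ α₄ / 4 → ‖t‖ ≤ α₄ / 4 → ∀ j, j ≤ k → ∀ x ∈ Ω j,
      ‖gpar (lamOf s) x - gpar (lamOf t) x‖ ≤ ℓ₀ * ‖s - t‖ ∧ ∀ μ : Fin d,
        wt L η j * ‖covDerivFwd η U₀ μ (gpar (lamOf s) - gpar (lamOf t)) x‖ ≤ ℓ₁ * ‖s - t‖ ∧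
        wt L η j * ‖covDeriv η U₀ μ (gpar (lamOf s) - gpar (lamOf t)) x‖ ≤ ℓ₁ * ‖s - t‖)
    (hE0 : ∀ s : lamSubK η U₀ L k Eb, ‖s‖ ≤ α₄ / 4 → Bd2 L η k Ω (Eterm (lamOf s)) mE)
    (hEL : ∀ s t : lamSubK η U₀ L k Eb, ‖s‖ ≤ α₄ / 4 → ‖t‖ ≤ α₄ / 4 → Bd2 L η k Ω (Eterm (lamOf s) - Eterm (lamOf t)) (KE * ‖s - t‖))
    (hDA : Bd2 L η k Ω DA cDA) (hf : Bd2 L η k Ω f mf)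
    (hA : ∀ j, j ≤ k → ∀ x ∈ Ω j, ∀ μ : Fin d,
      wt L η j * ‖A x μ‖ ≤ cA ∧ wt L η j * ‖conjR (U₀ (x - e μ) μ)⁻¹ (A (x - e μ) μ)‖ ≤ cA)
    (s t : lamSubK η U₀ L k Eb) (hs : ‖s‖ ≤ α₄ / 4) (ht : ‖t‖ ≤ α₄ / 4) :
    Bd2 L η k Ω (PsiP5src η U₀ A DA f R gpar Eterm (lamOf s) - PsiP5src η U₀ A DA f R gpar Eterm (lamOf t))
      (Kc d BR b₁ cA (mE + mf / 2) cDA KE ℓ₀ ℓ₁ * ‖s - t‖) := by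
  set mW := mWc d b₁ cA (mE + mf / 2) cDA with hmWdef
  have hmE' : 0 ≤ mE + mf / 2 := by positivity
  have hmW : 0 ≤ mW := mWc_nonneg hb₁.le hcA hmE' hcDA
  have hcV : 0 ≤ 10 * a₁ := by positivity
  have ha12 : a₁ ≤ 1 / 12 := by linarith
  have hb70 : b₁ ≤ 1 / 70 := by linarith
  have hcA12 : cA ≤ 1 / 12 := by linarith
  have hVsub : ∀ s : lamSubK η U₀ L k Eb, ‖s‖ ≤ α₄ / 4 → ∀ f g : Site d → 𝔸, ∀ j, j ≤ k → ∀ x ∈ Ω j,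
      Vop (gpar (lamOf s)) f x - Vop (gpar (lamOf s)) g x = Vop (gpar (lamOf s)) (f - g) x :=
    fun s hs f g j hj x hx => Vop_sub f g ((hg0 s hs j hj x hx).trans ha12)
  have hVbd : ∀ s : lamSubK η U₀ L k Eb, ‖s‖ ≤ α₄ / 4 → ∀ f : Site d → 𝔸, ∀ j, j ≤ k → ∀ x ∈ Ω j,
      ‖Vop (gpar (lamOf s)) f x‖ ≤ 10 * a₁ * ‖f x‖ :=
    fun s hs f j hj x hx => norm_Vop_le f (hg0 s hs j hj x hx) ha12
  have hW : ∀ s : lamSubK η U₀ L k Eb, ‖s‖ ≤ α₄ / 4 → Bd2 L η k Ω (Wsrc η U₀ A DA (gpar (lamOf s)) (Eterm (lamOf s)) - f) mW := by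
    intro s hs
    have h : Bd2 L η k Ω (Wsrc η U₀ A DA (gpar (lamOf s)) (Eterm (lamOf s))) (mWc d b₁ cA mE cDA) :=
      fun j hj x hx => wt_sq_norm_Wsrc_le hL hη hb70 hcA hcA12 ((hg0 s hs j hj x hx).trans ha12) (hg1 s hs j hj x hx) (hA j hj x hx)
        (hE0 s hs j hj x hx) (hDA j hj x hx)
    rw [hmWdef, ← mWc_add_half]; exact h.sub hf
  have hδ : 0 ≤ ‖s - t‖ := norm_nonneg _
  have hKW : 0 ≤ KWc d b₁ cA mE cDA KE ℓ₀ ℓ₁ := KWc_nonneg hb₁.le hcA hmE hcDA hKE hℓ₀ hℓ₁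
  have hKW' : 0 ≤ KWc d b₁ cA (mE + mf / 2) cDA KE ℓ₀ ℓ₁ := KWc_nonneg hb₁.le hcA hmE' hcDA hKE hℓ₀ hℓ₁
  -- the source cancels in `W_s − W_t`: the engine's modulus, then monotonicity in `mE`
  have hdW : Bd2 L η k Ω ((Wsrc η U₀ A DA (gpar (lamOf s)) (Eterm (lamOf s)) - f) - (Wsrc η U₀ A DA (gpar (lamOf t)) (Eterm (lamOf t)) - f))
      (KWc d b₁ cA (mE + mf / 2) cDA KE ℓ₀ ℓ₁ * ‖s - t‖) := by
    intro j hj x hx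
    have h := wt_sq_norm_Wsrc_sub_le (U₀ := U₀) (A := A) (DA := DA) hL hη hb₁ hb₁' hcA hcA' (by positivity : 0 ≤ ℓ₀ * ‖s - t‖)
      ((hg0 s hs j hj x hx).trans ha₁') ((hg0 t ht j hj x hx).trans ha₁') (hg1 s hs j hj x hx) (hg1 t ht j hj x hx) (hA j hj x hx)
      (hE0 t ht j hj x hx) (hDA j hj x hx) (hgL s t hs ht j hj x hx).1 (fun μ => (hgL s t hs ht j hj x hx).2 μ)
      (by simpa only [Pi.sub_apply] using hEL s t hs ht j hj x hx)
    have hcancel : ((Wsrc η U₀ A DA (gpar (lamOf s)) (Eterm (lamOf s)) - f) - (Wsrc η U₀ A DA (gpar (lamOf t)) (Eterm (lamOf t)) - f)) x =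
        Wsrc η U₀ A DA (gpar (lamOf s)) (Eterm (lamOf s)) x - Wsrc η U₀ A DA (gpar (lamOf t)) (Eterm (lamOf t)) x := by
      simp only [Pi.sub_apply]; abel
    rw [hcancel]
    refine h.trans ?_
    have heq : 18 * cDA * (ℓ₀ * ‖s - t‖) + 2 * (KE * ‖s - t‖) + 10 * mE * (ℓ₀ * ‖s - t‖) +
        d * (438 * b₁ * (ℓ₁ * ‖s - t‖) + 1968 * b₁ ^ 2 * (ℓ₀ * ‖s - t‖) + 68 * cA * (ℓ₁ * ‖s - t‖) + 808 * cA * b₁ * (ℓ₀ * ‖s - t‖)) =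
        KWc d b₁ cA mE cDA KE ℓ₀ ℓ₁ * ‖s - t‖ := by unfold KWc; ring
    rw [heq]
    exact mul_le_mul_of_nonneg_right (KWc_le_add_half d hmf hℓ₀) hδ
  have hdV : ∀ g : Site d → 𝔸, ∀ j, j ≤ k → ∀ x ∈ Ω j,
      ‖Vop (gpar (lamOf s)) g x - Vop (gpar (lamOf t)) g x‖ ≤ 10 * ℓ₀ * ‖s - t‖ * ‖g x‖ := by
    intro g j hj x hx
    have h := norm_Vop_sub_Vop_le g ((hg0 s hs j hj x hx).trans ha12) ((hg0 t ht j hj x hx).trans ha12)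
    calc ‖Vop (gpar (lamOf s)) g x - Vop (gpar (lamOf t)) g x‖ ≤ 10 * ‖g x‖ * ‖gpar (lamOf s) x - gpar (lamOf t) x‖ := h
      _ ≤ 10 * ‖g x‖ * (ℓ₀ * ‖s - t‖) := by gcongr; exact (hgL s t hs ht j hj x hx).1
      _ = 10 * ℓ₀ * ‖s - t‖ * ‖g x‖ := by ring
  have hZZ := bd2_zsol_sub_zsol hL hη (hVsub s hs) (hVbd s hs) (hVsub t ht) (hVbd t ht) hRsub hRbd (hW s hs) (hW t ht) hcV hBR hmW hθ
    (mul_nonneg hKW' hδ) (by positivity : 0 ≤ 10 * ℓ₀ * ‖s - t‖) hdW hdV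
  have h2c : 0 ≤ 2 * (KWc d b₁ cA (mE + mf / 2) cDA KE ℓ₀ ℓ₁ * ‖s - t‖ + 10 * ℓ₀ * ‖s - t‖ * (BR * (2 * mW))) := by positivity
  have hneg := hRbd _ _ h2c hZZ.neg
  intro j hj x hx
  have h := hneg j hj x hx
  have heq : (PsiP5src η U₀ A DA f R gpar Eterm (lamOf s) - PsiP5src η U₀ A DA f R gpar Eterm (lamOf t)) x =
      R (-(Zsol (Wsrc η U₀ A DA (gpar (lamOf s)) (Eterm (lamOf s)) - f) (Vop (gpar (lamOf s))) R -
        Zsol (Wsrc η U₀ A DA (gpar (lamOf t)) (Eterm (lamOf t)) - f) (Vop (gpar (lamOf t))) R)) x := by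
    simp only [PsiP5src, Pi.sub_apply]
    rw [← Pi.sub_apply (R _) (R _), ← hRsub]
    congr 1
    funext y; simp only [Pi.sub_apply, Pi.neg_apply]; abel
  rw [heq]
  refine h.trans (le_of_eq ?_)
  unfold Kc; ring

end PsiBounds

/-! ## §2 The fixed point of (1.100) with a source, and what it carries -/

section FixedPoint

variable {𝔸 : Type*} [NormedRing 𝔸] [NormOneClass 𝔸] [NormedAlgebra ℂ 𝔸] [CompleteSpace 𝔸]
variable {L k : ℕ} {η : ℝ} {Ω : ℕ → Set (Site d)} {Eb : ℕ → Set (Site d × Fin d)} {U₀ : Site d → Fin d → 𝔸ˣ}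
  {A : Site d → Fin d → 𝔸} {DA f : Site d → 𝔸}

/-- ★ **THE FIXED POINT OF (1.100) WITH A SOURCE, AT `k` LEVELS, ON THE CONCRETE `ℤᵈ × 𝔸` CARRIERS** — `B8Prop5ContractionKLevel.propFive_fixedPoint_kLevel`
for the sourced nonlinearity `Ψ_f` (Theorem 8's (1.146)): for the letters `G′` ((1.101)-shape bound `hG`, additive) and `R` ((1.98)R `hRbd`, additive), a
gauge-parameter map `gpar` (λ ↦ λ′) with the displayed sizes and moduli on the closed ¼α₄-ball, a linearisation defect `Eterm` (size `m_E`, modulus `K_E`),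
the data `DA` (`|DA|₍₋₂₎ ≤ c_{DA}`), `A` (`(Lʲη)‖A‖ ≤ c_A ≤ 1∕13`) AND A SOURCE `f` WITH `|f|₍₋₂₎ ≤ m_f` ON THE `Ω_j`, under `10a₁B_R ≤ ½` and the two smallness
conditions (1.103)∕(1.106) on the engine's explicit `M = Mc …`, `K = Kc …` READ AT `mE + m_f∕2`: **there is exactly one `s` with `‖s‖ ≤ ¼α₄` and
`λ_s = G′(Ψ_f λ_s)`**.  Nothing of [4] or of Sect. E is proved: they are the displayed hypotheses. [cite: Balaban1985RegularSpaces, p.94 (after (1.106)), (1.100)–(1.103) p.93, Thm 8 (1.146) p.101 («only some constants change»)] -/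
theorem propFive_fixedPoint_kLevel_src (hL : 1 ≤ L) (hη : 0 < η)
    (Gp R gpar Eterm : (Site d → 𝔸) → (Site d → 𝔸))
    {α₄ BG BR a₁ b₁ cA cDA mE KE ℓ₀ ℓ₁ mf : ℝ}
    (hα₄ : 0 ≤ α₄) (hBG : 0 ≤ BG) (hBR : 0 ≤ BR) (ha₁ : 0 ≤ a₁) (ha₁' : a₁ ≤ 1 / 24) (hb₁ : 0 < b₁) (hb₁' : b₁ ≤ 1 / 140)
    (hcA : 0 ≤ cA) (hcA' : cA ≤ 1 / 13) (hcDA : 0 ≤ cDA) (hmE : 0 ≤ mE) (hKE : 0 ≤ KE) (hℓ₀ : 0 ≤ ℓ₀) (hℓ₁ : 0 ≤ ℓ₁) (hmf : 0 ≤ mf)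
    (hθ : 10 * a₁ * BR ≤ 1 / 2)
    (hG : ∀ (f : Site d → 𝔸) (m : ℝ), 0 ≤ m → Bd2 L η k Ω f m →
      (∀ x, ‖Gp f x‖ ≤ BG * m) ∧ ∀ j, j ≤ k → ∀ p ∈ Eb j, wt L η j * ‖covDerivFwd η U₀ p.2 (Gp f) p.1‖ ≤ BG * m)
    (hGsub : ∀ f g : Site d → 𝔸, Gp (f - g) = Gp f - Gp g)
    (hRsub : ∀ f g : Site d → 𝔸, R (f - g) = R f - R g)
    (hRbd : ∀ (f : Site d → 𝔸) (m : ℝ), 0 ≤ m → Bd2 L η k Ω f m → Bd2 L η k Ω (R f) (BR * m))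
    (hg0 : ∀ s : lamSubK η U₀ L k Eb, ‖s‖ ≤ α₄ / 4 → ∀ j, j ≤ k → ∀ x ∈ Ω j, ‖gpar (lamOf s) x‖ ≤ a₁)
    (hg1 : ∀ s : lamSubK η U₀ L k Eb, ‖s‖ ≤ α₄ / 4 → ∀ j, j ≤ k → ∀ x ∈ Ω j, ∀ μ : Fin d,
      wt L η j * ‖covDerivFwd η U₀ μ (gpar (lamOf s)) x‖ ≤ b₁ ∧ wt L η j * ‖covDeriv η U₀ μ (gpar (lamOf s)) x‖ ≤ b₁)
    (hgL : ∀ s t : lamSubK η U₀ L k Eb, ‖s‖ ≤ α₄ / 4 → ‖t‖ ≤ α₄ / 4 → ∀ j, j ≤ k → ∀ x ∈ Ω j,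
      ‖gpar (lamOf s) x - gpar (lamOf t) x‖ ≤ ℓ₀ * ‖s - t‖ ∧ ∀ μ : Fin d,
        wt L η j * ‖covDerivFwd η U₀ μ (gpar (lamOf s) - gpar (lamOf t)) x‖ ≤ ℓ₁ * ‖s - t‖ ∧
        wt L η j * ‖covDeriv η U₀ μ (gpar (lamOf s) - gpar (lamOf t)) x‖ ≤ ℓ₁ * ‖s - t‖)
    (hE0 : ∀ s : lamSubK η U₀ L k Eb, ‖s‖ ≤ α₄ / 4 → Bd2 L η k Ω (Eterm (lamOf s)) mE)
    (hEL : ∀ s t : lamSubK η U₀ L k Eb, ‖s‖ ≤ α₄ / 4 → ‖t‖ ≤ α₄ / 4 → Bd2 L η k Ω (Eterm (lamOf s) - Eterm (lamOf t)) (KE * ‖s - t‖))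
    (hDA : Bd2 L η k Ω DA cDA) (hf : Bd2 L η k Ω f mf)
    (hA : ∀ j, j ≤ k → ∀ x ∈ Ω j, ∀ μ : Fin d,
      wt L η j * ‖A x μ‖ ≤ cA ∧ wt L η j * ‖conjR (U₀ (x - e μ) μ)⁻¹ (A (x - e μ) μ)‖ ≤ cA)
    (h103 : BG * Mc d BR b₁ cA (mE + mf / 2) cDA ≤ α₄ / 4) (h106 : BG * Kc d BR b₁ cA (mE + mf / 2) cDA KE ℓ₀ ℓ₁ ≤ 1 / 2) :
    ∃! s : lamSubK η U₀ L k Eb, ‖s‖ ≤ α₄ / 4 ∧ lamOf s = Gp (PsiP5src η U₀ A DA f R gpar Eterm (lamOf s)) := by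
  have hmE' : 0 ≤ mE + mf / 2 := by positivity
  have hM0 : 0 ≤ Mc d BR b₁ cA (mE + mf / 2) cDA := by
    have := mWc_nonneg (d := d) hb₁.le hcA hmE' hcDA; unfold Mc; positivity
  have hKW : 0 ≤ KWc d b₁ cA (mE + mf / 2) cDA KE ℓ₀ ℓ₁ := KWc_nonneg hb₁.le hcA hmE' hcDA hKE hℓ₀ hℓ₁
  have hK0 : 0 ≤ Kc d BR b₁ cA (mE + mf / 2) cDA KE ℓ₀ ℓ₁ := by
    have := mWc_nonneg (d := d) hb₁.le hcA hmE' hcDA; unfold Kc; positivity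
  exact fixedPoint_kLevel hη.le Ω Gp (PsiP5src η U₀ A DA f R gpar Eterm) hα₄ hBG hM0 hK0
    (fun f m hm hf => hG f m hm hf) hGsub
    (fun s hs => psiP5src_bd2 (Ω := Ω) (Eb := Eb) hL hη R gpar Eterm hBR ha₁ ha₁' hb₁ hb₁' hcA hcA' hcDA hmE hmf hθ hRsub hRbd hg0 hg1 hE0
      hDA hf hA s hs)
    (fun s t hs ht j hj x hx => by
      simpa only [Pi.sub_apply] using psiP5src_sub_bd2 (Ω := Ω) (Eb := Eb) hL hη R gpar Eterm hBR ha₁ ha₁' hb₁ hb₁' hcA hcA' hcDA hmE hKE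
        hℓ₀ hℓ₁ hmf hθ hRsub hRbd hg0 hg1 hgL hE0 hEL hDA hf hA s t hs ht j hj x hx)
    h103 h106

/-- **WHAT THE SOURCED FIXED POINT CARRIES** — `B8Prop5ContractionKLevel.propFive_fixedPoint_kLevel_spec` for `Ψ_f`: for any `s` in the ball with
`λ_s = G′(Ψ_f λ_s)` — (a) the NEUMANN IDENTITY WITH SOURCE `Z′ + V_{λ′}(RZ′) = W − f` on every `Ω_j` (so that (1.88) + `R² = R` give `R(D*A′ − f) = 0`:
`D*A′ − f = W − f − V(RZ′)·… = Z′ − RZ′`); (b) `|Z′|₍₋₂₎ ≤ 2·mWc(mE + m_f∕2)`; (c) `‖s‖ ≤ B_G·M` ((1.108)'s source); (d) `λ_s = 0` off `Ω₀` under the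
Dirichlet range of `G′`. [cite: Balaban1985RegularSpaces, (1.95)–(1.96) p.92, (1.108) p.94, Thm 8 (1.146) p.101; Balaban1985BackgroundPropagators, (3.24) p.394] -/
theorem propFive_fixedPoint_kLevel_src_spec (hL : 1 ≤ L) (hη : 0 < η)
    (Gp R gpar Eterm : (Site d → 𝔸) → (Site d → 𝔸))
    {α₄ BG BR a₁ b₁ cA cDA mE mf : ℝ}
    (hBR : 0 ≤ BR) (ha₁ : 0 ≤ a₁) (ha₁' : a₁ ≤ 1 / 24) (hb₁ : 0 < b₁) (hb₁' : b₁ ≤ 1 / 140)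
    (hcA : 0 ≤ cA) (hcA' : cA ≤ 1 / 13) (hcDA : 0 ≤ cDA) (hmE : 0 ≤ mE) (hmf : 0 ≤ mf) (hθ : 10 * a₁ * BR ≤ 1 / 2)
    (hG : ∀ (f : Site d → 𝔸) (m : ℝ), 0 ≤ m → Bd2 L η k Ω f m →
      (∀ x, ‖Gp f x‖ ≤ BG * m) ∧ ∀ j, j ≤ k → ∀ p ∈ Eb j, wt L η j * ‖covDerivFwd η U₀ p.2 (Gp f) p.1‖ ≤ BG * m)
    (hGsupp : ∀ (f : Site d → 𝔸) (x : Site d), x ∉ Ω 0 → Gp f x = 0)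
    (hRsub : ∀ f g : Site d → 𝔸, R (f - g) = R f - R g)
    (hRbd : ∀ (f : Site d → 𝔸) (m : ℝ), 0 ≤ m → Bd2 L η k Ω f m → Bd2 L η k Ω (R f) (BR * m))
    (hg0 : ∀ s : lamSubK η U₀ L k Eb, ‖s‖ ≤ α₄ / 4 → ∀ j, j ≤ k → ∀ x ∈ Ω j, ‖gpar (lamOf s) x‖ ≤ a₁)
    (hg1 : ∀ s : lamSubK η U₀ L k Eb, ‖s‖ ≤ α₄ / 4 → ∀ j, j ≤ k → ∀ x ∈ Ω j, ∀ μ : Fin d,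
      wt L η j * ‖covDerivFwd η U₀ μ (gpar (lamOf s)) x‖ ≤ b₁ ∧ wt L η j * ‖covDeriv η U₀ μ (gpar (lamOf s)) x‖ ≤ b₁)
    (hE0 : ∀ s : lamSubK η U₀ L k Eb, ‖s‖ ≤ α₄ / 4 → Bd2 L η k Ω (Eterm (lamOf s)) mE)
    (hDA : Bd2 L η k Ω DA cDA) (hf : Bd2 L η k Ω f mf)
    (hA : ∀ j, j ≤ k → ∀ x ∈ Ω j, ∀ μ : Fin d,
      wt L η j * ‖A x μ‖ ≤ cA ∧ wt L η j * ‖conjR (U₀ (x - e μ) μ)⁻¹ (A (x - e μ) μ)‖ ≤ cA)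
    {s : lamSubK η U₀ L k Eb} (hs : ‖s‖ ≤ α₄ / 4) (hfix : lamOf s = Gp (PsiP5src η U₀ A DA f R gpar Eterm (lamOf s))) :
    (∀ j, j ≤ k → ∀ x ∈ Ω j,
      Zsol (Wsrc η U₀ A DA (gpar (lamOf s)) (Eterm (lamOf s)) - f) (Vop (gpar (lamOf s))) R x +
        Vop (gpar (lamOf s)) (R (Zsol (Wsrc η U₀ A DA (gpar (lamOf s)) (Eterm (lamOf s)) - f) (Vop (gpar (lamOf s))) R)) x =
      Wsrc η U₀ A DA (gpar (lamOf s)) (Eterm (lamOf s)) x - f x) ∧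
    Bd2 L η k Ω (Zsol (Wsrc η U₀ A DA (gpar (lamOf s)) (Eterm (lamOf s)) - f) (Vop (gpar (lamOf s))) R) (2 * mWc d b₁ cA (mE + mf / 2) cDA) ∧
    ‖s‖ ≤ BG * Mc d BR b₁ cA (mE + mf / 2) cDA ∧
    (∀ x, x ∉ Ω 0 → lamOf s x = 0) := by
  set mW := mWc d b₁ cA (mE + mf / 2) cDA with hmWdef
  have hmE' : 0 ≤ mE + mf / 2 := by positivity
  have hmW : 0 ≤ mW := mWc_nonneg hb₁.le hcA hmE' hcDA
  have hcV : 0 ≤ 10 * a₁ := by positivity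
  have ha12 : a₁ ≤ 1 / 12 := by linarith
  have hb70 : b₁ ≤ 1 / 70 := by linarith
  have hcA12 : cA ≤ 1 / 12 := by linarith
  have hVsub : ∀ f g : Site d → 𝔸, ∀ j, j ≤ k → ∀ x ∈ Ω j,
      Vop (gpar (lamOf s)) f x - Vop (gpar (lamOf s)) g x = Vop (gpar (lamOf s)) (f - g) x :=
    fun f g j hj x hx => Vop_sub f g ((hg0 s hs j hj x hx).trans ha12)
  have hVbd : ∀ f : Site d → 𝔸, ∀ j, j ≤ k → ∀ x ∈ Ω j, ‖Vop (gpar (lamOf s)) f x‖ ≤ 10 * a₁ * ‖f x‖ :=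
    fun f j hj x hx => norm_Vop_le f (hg0 s hs j hj x hx) ha12
  have hW0 : Bd2 L η k Ω (Wsrc η U₀ A DA (gpar (lamOf s)) (Eterm (lamOf s))) (mWc d b₁ cA mE cDA) :=
    fun j hj x hx => wt_sq_norm_Wsrc_le hL hη hb70 hcA hcA12 ((hg0 s hs j hj x hx).trans ha12) (hg1 s hs j hj x hx) (hA j hj x hx)
      (hE0 s hs j hj x hx) (hDA j hj x hx)
  have hW : Bd2 L η k Ω (Wsrc η U₀ A DA (gpar (lamOf s)) (Eterm (lamOf s)) - f) mW := by
    rw [hmWdef, ← mWc_add_half]; exact hW0.sub hf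
  have hZ := bd2_zsol hL hη hVsub hVbd hRsub hRbd hW hcV hBR hmW hθ
  refine ⟨fun j hj x hx => ?_, hZ, ?_, ?_⟩
  · have h := zsol_eq hL hη hVsub hVbd hRsub hRbd hW hcV hBR hmW hθ hj hx
    rw [h, Pi.sub_apply]
  · -- ‖s‖ ≤ B_G·M from the fixed-point equation and the letter bound
    have hΨ : Bd2 L η k Ω (PsiP5src η U₀ A DA f R gpar Eterm (lamOf s)) (Mc d BR b₁ cA (mE + mf / 2) cDA) :=
      hRbd _ _ (by positivity) hZ.neg
    have hB : 0 ≤ BG * Mc d BR b₁ cA (mE + mf / 2) cDA := by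
      obtain ⟨h0, -⟩ := hG _ _ (by unfold Mc; positivity) hΨ
      exact (norm_nonneg _).trans (h0 0)
    refine (norm_le_iff hη.le s hB).2 ⟨fun x => ?_, fun j hj p hp => ?_⟩
    · rw [hfix]; exact (hG _ _ (by unfold Mc; positivity) hΨ).1 x
    · rw [hfix]; exact (hG _ _ (by unfold Mc; positivity) hΨ).2 j hj p hp
  · intro x hx
    rw [hfix]; exact hGsupp _ x hx

end FixedPoint

/-! ## §3 The sourced fixed point is a REAL configuration (Hermitian source) -/

section Reality

variable {𝔸 : Type*} [CStarAlgebra 𝔸] [Nontrivial 𝔸]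
variable {L k : ℕ} {η : ℝ} {Ω : ℕ → Set (Site d)} {Eb : ℕ → Set (Site d × Fin d)} {U₀ : Site d → Fin d → 𝔸ˣ}
  {A : Site d → Fin d → 𝔸} {DA f : Site d → 𝔸}

/-- **THE SOURCED FIXED POINT IS HERMITIAN** — `B8Prop5Reality.propFive_fixedPoint_kLevel_selfAdjoint` for `Ψ_f`: in the setting of
`propFive_fixedPoint_kLevel_src`, assume the DISPLAYED REALITY of the data (`U₀` unitary, `A`, `D*A` Hermitian, `gpar`∕`Eterm` Hermitian-preserving on
the ball, `R` and `G′` Hermitian-preserving) AND `f` HERMITIAN ON THE `Ω_j` (print: `f ∈ R(U₀)`, a space of 𝔤-valued functions); then `λ_s(x)` is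
Hermitian at every site. [cite: Balaban1985RegularSpaces, p.93 (after (1.102)), (1.100) p.93, Thm 8 (1.146) p.101] -/
theorem propFive_fixedPoint_kLevel_src_selfAdjoint (hL : 1 ≤ L) (hη : 0 < η) (hU₀ : ∀ x κ, U₀ x κ ∈ unitaryUnits 𝔸)
    (Gp R gpar Eterm : (Site d → 𝔸) → (Site d → 𝔸))
    {α₄ BG BR a₁ b₁ cA cDA mE KE ℓ₀ ℓ₁ mf : ℝ}
    (hα₄ : 0 ≤ α₄) (hBG : 0 ≤ BG) (hBR : 0 ≤ BR) (ha₁ : 0 ≤ a₁) (ha₁' : a₁ ≤ 1 / 24) (hb₁ : 0 < b₁) (hb₁' : b₁ ≤ 1 / 140)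
    (hcA : 0 ≤ cA) (hcA' : cA ≤ 1 / 13) (hcDA : 0 ≤ cDA) (hmE : 0 ≤ mE) (hKE : 0 ≤ KE) (hℓ₀ : 0 ≤ ℓ₀) (hℓ₁ : 0 ≤ ℓ₁) (hmf : 0 ≤ mf)
    (hθ : 10 * a₁ * BR ≤ 1 / 2)
    (hG : ∀ (f : Site d → 𝔸) (m : ℝ), 0 ≤ m → Bd2 L η k Ω f m →
      (∀ x, ‖Gp f x‖ ≤ BG * m) ∧ ∀ j, j ≤ k → ∀ p ∈ Eb j, wt L η j * ‖covDerivFwd η U₀ p.2 (Gp f) p.1‖ ≤ BG * m)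
    (hGsub : ∀ f g : Site d → 𝔸, Gp (f - g) = Gp f - Gp g)
    (hRsub : ∀ f g : Site d → 𝔸, R (f - g) = R f - R g)
    (hRbd : ∀ (f : Site d → 𝔸) (m : ℝ), 0 ≤ m → Bd2 L η k Ω f m → Bd2 L η k Ω (R f) (BR * m))
    (hg0 : ∀ s : lamSubK η U₀ L k Eb, ‖s‖ ≤ α₄ / 4 → ∀ j, j ≤ k → ∀ x ∈ Ω j, ‖gpar (lamOf s) x‖ ≤ a₁)
    (hg1 : ∀ s : lamSubK η U₀ L k Eb, ‖s‖ ≤ α₄ / 4 → ∀ j, j ≤ k → ∀ x ∈ Ω j, ∀ μ : Fin d,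
      wt L η j * ‖covDerivFwd η U₀ μ (gpar (lamOf s)) x‖ ≤ b₁ ∧ wt L η j * ‖covDeriv η U₀ μ (gpar (lamOf s)) x‖ ≤ b₁)
    (hgL : ∀ s t : lamSubK η U₀ L k Eb, ‖s‖ ≤ α₄ / 4 → ‖t‖ ≤ α₄ / 4 → ∀ j, j ≤ k → ∀ x ∈ Ω j,
      ‖gpar (lamOf s) x - gpar (lamOf t) x‖ ≤ ℓ₀ * ‖s - t‖ ∧ ∀ μ : Fin d,
        wt L η j * ‖covDerivFwd η U₀ μ (gpar (lamOf s) - gpar (lamOf t)) x‖ ≤ ℓ₁ * ‖s - t‖ ∧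
        wt L η j * ‖covDeriv η U₀ μ (gpar (lamOf s) - gpar (lamOf t)) x‖ ≤ ℓ₁ * ‖s - t‖)
    (hE0 : ∀ s : lamSubK η U₀ L k Eb, ‖s‖ ≤ α₄ / 4 → Bd2 L η k Ω (Eterm (lamOf s)) mE)
    (hEL : ∀ s t : lamSubK η U₀ L k Eb, ‖s‖ ≤ α₄ / 4 → ‖t‖ ≤ α₄ / 4 → Bd2 L η k Ω (Eterm (lamOf s) - Eterm (lamOf t)) (KE * ‖s - t‖))
    (hDA : Bd2 L η k Ω DA cDA) (hf : Bd2 L η k Ω f mf)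
    (hA : ∀ j, j ≤ k → ∀ x ∈ Ω j, ∀ μ : Fin d,
      wt L η j * ‖A x μ‖ ≤ cA ∧ wt L η j * ‖conjR (U₀ (x - e μ) μ)⁻¹ (A (x - e μ) μ)‖ ≤ cA)
    (h103 : BG * Mc d BR b₁ cA (mE + mf / 2) cDA ≤ α₄ / 4) (h106 : BG * Kc d BR b₁ cA (mE + mf / 2) cDA KE ℓ₀ ℓ₁ ≤ 1 / 2)
    -- reality of the data and of the source
    (hAsa : ∀ x μ, IsSelfAdjoint (A x μ)) (hDAsa : ∀ j, j ≤ k → ∀ x ∈ Ω j, IsSelfAdjoint (DA x))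
    (hfsa : ∀ j, j ≤ k → ∀ x ∈ Ω j, IsSelfAdjoint (f x))
    (hgsa : ∀ s : lamSubK η U₀ L k Eb, ‖s‖ ≤ α₄ / 4 → (∀ x, IsSelfAdjoint (lamOf s x)) → ∀ x, IsSelfAdjoint (gpar (lamOf s) x))
    (hEsa : ∀ s : lamSubK η U₀ L k Eb, ‖s‖ ≤ α₄ / 4 → (∀ x, IsSelfAdjoint (lamOf s x)) → ∀ j, j ≤ k → ∀ x ∈ Ω j,
      IsSelfAdjoint (Eterm (lamOf s) x))
    (hRreal : ∀ f : Site d → 𝔸, (∀ j, j ≤ k → ∀ x ∈ Ω j, IsSelfAdjoint (f x)) → ∀ j, j ≤ k → ∀ x ∈ Ω j, IsSelfAdjoint (R f x))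
    (hGreal : ∀ f : Site d → 𝔸, (∀ j, j ≤ k → ∀ x ∈ Ω j, IsSelfAdjoint (f x)) → ∀ x, IsSelfAdjoint (Gp f x))
    {s : lamSubK η U₀ L k Eb} (hs : ‖s‖ ≤ α₄ / 4) (hfix : lamOf s = Gp (PsiP5src η U₀ A DA f R gpar Eterm (lamOf s))) :
    ∀ x, IsSelfAdjoint (lamOf s x) := by
  have hmE' : 0 ≤ mE + mf / 2 := by positivity
  have hmW0 : 0 ≤ mWc d b₁ cA mE cDA := mWc_nonneg hb₁.le hcA hmE hcDA
  have hmW : 0 ≤ mWc d b₁ cA (mE + mf / 2) cDA := mWc_nonneg hb₁.le hcA hmE' hcDA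
  have hcV : 0 ≤ 10 * a₁ := by positivity
  have ha12 : a₁ ≤ 1 / 12 := by linarith
  have hb70 : b₁ ≤ 1 / 70 := by linarith
  have hcA12 : cA ≤ 1 / 12 := by linarith
  -- the invariance on the ball: every constituent preserves Hermitian data, and the source is Hermitian
  have hreal : ∀ t : lamSubK η U₀ L k Eb, ‖t‖ ≤ α₄ / 4 → (∀ x, IsSelfAdjoint (lamOf t x)) →
      ∀ x, IsSelfAdjoint (Gp (PsiP5src η U₀ A DA f R gpar Eterm (lamOf t)) x) := by
    intro t ht hsa
    have hasa : ∀ y, IsSelfAdjoint (gpar (lamOf t) y) := hgsa t ht hsa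
    have hVsub : ∀ f g : Site d → 𝔸, ∀ j, j ≤ k → ∀ x ∈ Ω j,
        Vop (gpar (lamOf t)) f x - Vop (gpar (lamOf t)) g x = Vop (gpar (lamOf t)) (f - g) x :=
      fun f g j hj x hx => Vop_sub f g ((hg0 t ht j hj x hx).trans ha12)
    have hVbd : ∀ f : Site d → 𝔸, ∀ j, j ≤ k → ∀ x ∈ Ω j, ‖Vop (gpar (lamOf t)) f x‖ ≤ 10 * a₁ * ‖f x‖ :=
      fun f j hj x hx => norm_Vop_le f (hg0 t ht j hj x hx) ha12
    have hW0 : Bd2 L η k Ω (Wsrc η U₀ A DA (gpar (lamOf t)) (Eterm (lamOf t))) (mWc d b₁ cA mE cDA) :=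
      fun j hj x hx => wt_sq_norm_Wsrc_le hL hη hb70 hcA hcA12 ((hg0 t ht j hj x hx).trans ha12) (hg1 t ht j hj x hx) (hA j hj x hx)
        (hE0 t ht j hj x hx) (hDA j hj x hx)
    have hW : Bd2 L η k Ω (Wsrc η U₀ A DA (gpar (lamOf t)) (Eterm (lamOf t)) - f) (mWc d b₁ cA (mE + mf / 2) cDA) := by
      rw [← mWc_add_half]; exact hW0.sub hf
    have hWsa : ∀ j, j ≤ k → ∀ x ∈ Ω j, IsSelfAdjoint ((Wsrc η U₀ A DA (gpar (lamOf t)) (Eterm (lamOf t)) - f) x) := by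
      intro j hj x hx
      rw [Pi.sub_apply]
      exact (isSelfAdjoint_Wsrc hL hη hU₀ hb₁' hcA' hasa (hEsa t ht hsa j hj x hx) (hDAsa j hj x hx) hAsa
        ((hg0 t ht j hj x hx).trans ha₁') (hg1 t ht j hj x hx) (hA j hj x hx)).sub (hfsa j hj x hx)
    have hVsa : ∀ f : Site d → 𝔸, ∀ j, j ≤ k → ∀ x ∈ Ω j, IsSelfAdjoint (f x) → IsSelfAdjoint (Vop (gpar (lamOf t)) f x) :=
      fun f j hj x hx hf => isSelfAdjoint_Vop (hasa x) ((hg0 t ht j hj x hx).trans ha12) hf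
    have hZsa : ∀ j, j ≤ k → ∀ x ∈ Ω j,
        IsSelfAdjoint (Zsol (Wsrc η U₀ A DA (gpar (lamOf t)) (Eterm (lamOf t)) - f) (Vop (gpar (lamOf t))) R x) :=
      fun j hj x hx => isSelfAdjoint_zsol hL hη hVsub hVbd hRsub hRbd hW hcV hBR hmW hθ hWsa hVsa hRreal hj hx
    refine hGreal _ (hRreal _ fun j hj x hx => ?_)
    exact (hZsa j hj x hx).neg
  have hM0 : 0 ≤ Mc d BR b₁ cA (mE + mf / 2) cDA := by unfold Mc; positivity
  have hKW : 0 ≤ KWc d b₁ cA (mE + mf / 2) cDA KE ℓ₀ ℓ₁ := KWc_nonneg hb₁.le hcA hmE' hcDA hKE hℓ₀ hℓ₁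
  have hK0 : 0 ≤ Kc d BR b₁ cA (mE + mf / 2) cDA KE ℓ₀ ℓ₁ := by unfold Kc; positivity
  exact fixedPoint_kLevel_selfAdjoint_of_ball hη.le Ω Gp (PsiP5src η U₀ A DA f R gpar Eterm) hα₄ hBG hM0 hK0
    (fun f m hm hf => hG f m hm hf) hGsub
    (fun t ht => psiP5src_bd2 (Ω := Ω) (Eb := Eb) hL hη R gpar Eterm hBR ha₁ ha₁' hb₁ hb₁' hcA hcA' hcDA hmE hmf hθ hRsub hRbd hg0 hg1 hE0
      hDA hf hA t ht)
    (fun t₁ t₂ ht₁ ht₂ j hj x hx => by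
      simpa only [Pi.sub_apply] using psiP5src_sub_bd2 (Ω := Ω) (Eb := Eb) hL hη R gpar Eterm hBR ha₁ ha₁' hb₁ hb₁' hcA hcA' hcDA hmE hKE
        hℓ₀ hℓ₁ hmf hθ hRsub hRbd hg0 hg1 hgL hE0 hEL hDA hf hA t₁ t₂ ht₁ ht₂ j hj x hx)
    h103 h106 hreal hs hfix

end Reality

end Literature.MathematicalPhysics.QuantumFieldTheory.Balaban1983to89.B8Prop5ContractionKLevelSrc

end
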